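import Literature.NumberTheory.K2Lit.SiegelEisensteinSeriesDoubled
import Literature.NumberTheory.K2Lit.SiegelEisensteinSeriesUnitary
import Literature.NumberTheory.K2Lit.SiegelStandardSections
import Summits.HodgeConjecture.HodgeConjecture.Theorems.K2LiuSiegelCharacterTrivialOnRational
import Summits.HodgeConjecture.HodgeConjecture.Theorems.K2LiuSiegelEisensteinDoubledLeftInvariant
import Summits.HodgeConjecture.HodgeConjecture.Theorems.K2LiuSiegelDeltaHeightExists             -- ★ p854993 (K2Liu-p07): #15a PAID, tied ED. 3
import Summits.HodgeConjecture.HodgeConjecture.Theorems.K2LiuIwasawaDatumNonempty           -- ★ p855101 (K2Liu-p09): «IWASAWA» PAID, tied ED. 4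
import Summits.HodgeConjecture.HodgeConjecture.Theorems.K2LiuSiegelEisensteinDoubledSummable   -- ★ p856279 (K2Liu-p09 g0): #9 PAID, tied ED. 5
import Summits.HodgeConjecture.HodgeConjecture.Theorems.K2LiuSiegelDeltaHeightCount            -- ★ p856397 (K2Liu-p09 g2): #15b PAID, tied ED. 5

/-!
# K2_Liu_CurveThetaSigs — unit U3a «SIEGEL EISENSTEIN SERIES» (tier-1 socket module for hLiu418 = stmt-HodgeConjecture-24832)

Track B ∕ build stream 29 (`Cruxes/HLiu418/Lines/K2_Liu_*`). Planner `hodgecm-mathlib-K2Liu-plan` g0,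
2026-09-03. INFO-ONLY companion to the #184♮ LINE `Cruxes/HLiu418/Lines/K2_Liu_CurveThetaNonOrthogonal.lean`
(A-plan2 (g33)). Sockets of unit U3a (Liu 2021 §B.3 p. 101: the degenerate principal series
`J_a(s, μᶜ) = Ind_{P_a}(μᶜ |·|^s) ∘ det` and the Siegel–hermitian Eisenstein series `E_{P_a}(·; f_{a,s})`,
«absolutely convergent for Re(s) > (n+a)/2, see [Tan99, Section 1]»), typed over the two DEFS leaves that
landed tonight: ★ `Literature/NumberTheory/K2Lit/SiegelEisensteinSeriesDoubled.lean` (p854694, commit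
17d1c9840378: `siegelDelta`, `siegelDeltaCharacter`, `IsSiegelDeltaSection`, `SiegelDeltaQuot`,
`eisensteinSeriesDelta` on the DOUBLED group ★ `GRConstruction.HA = U(𝕍 ⊕ −𝕍)(𝔸)` of the CM datum of record —
the `a = 0` case, roads S-A and S-B) and ★ `…/SiegelEisensteinSeriesUnitary.lean` (p854674, commit d971dfe1e7a6:
the SPLIT model `U(J_{m,m})`, rank-generic, road S-A's tower). See the SIG TABLE card
`Cruxes/HLiu418/Lines/K2_Liu_CurveThetaSigs.md` rows #9–#10 and `K2/K2Liu-plan/g0/DEPMAP-PRICE-184nat.v1.K2Liu-plan-g0.md` §4.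
One `theorem sig_<File> : ‹statement› := by sorry` per planned file; no `def`/`instance`/`notation`.
ED. 5 (2026-09-04 ≈01:25Z, planner g2; TIE-ONLY edition under LEAD F0P6-plan (g10) standing pre-authorisation 01:08:35Z (1)): #9
`sig_K2LiuSiegelEisensteinDoubledSummable` TIED BY NAME to ★ p856279 `Theorems/K2LiuSiegelEisensteinDoubledSummable` (K2Liu-p09 g0; Godement chain:
`parabolicIntegral` (E5′) + ★ #15a height + ★ «IWASAWA»; cast-free `:= …siegelEisensteinDoubledSummable`) and #15b `sig_K2LiuSiegelDeltaHeightCount`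
TIED BY NAME to ★ p856397 `Theorems/K2LiuSiegelDeltaHeightCount` (K2Liu-p09 g2; `summable_height_rpow`; cast-free `:= …siegelDeltaHeightCount`);
both statements byte-identical to ED. 4 11972aebc302fe47; live sorries 0 — UNIT U3a FULLY ★-TIED.
ED. 4 (2026-09-03 ≈22:55Z): «IWASAWA» `sig_K2LiuIwasawaDatumNonempty` TIED BY NAME to ★ p855101 `Theorems/K2LiuIwasawaDatumNonempty` (K2Liu-p09; statement
byte-identical, K2Liu-p06 compare ✓ 22:44:20Z; cast-free `:= …iwasawaDatumNonempty`); live sorries 2 = #9 `sig_K2LiuSiegelEisensteinDoubledSummable`, #15b `sig_K2LiuSiegelDeltaHeightCount`.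
ED. 3 (2026-09-03 ≈21:58Z): #15a TIED BY NAME to ★ p854993 `Theorems/K2LiuSiegelDeltaHeightExists` (K2Liu-p07; statement byte-identical,
continuity INCLUDED via `exists_siegelHeight_continuous` over K2Liu-p09's ★ p854922 height of record `exists_siegelHeight`, LEAD RULING 21:38:45Z);
#15b RE-TYPED IN PLACE on the owner's words BEFORE any TAKE (K2Liu-p09 «≠» 21:40:57Z; LEAD rule «prover's words win before TAKE» 21:38:45Z):
the binder `Continuous Φ →` is REPLACED by the two floors of ★ `exists_siegelHeight` — (3) `(∀ K, IsCompact K → ∃ c, 0 < c ∧ ∀ k ∈ K, c ≤ Φ k) →`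
and (4) the GODEMENT FLOOR `(∀ K, IsCompact K → ∃ C, ∀ k ∈ K, ∀ γ : ratH …, Φ (↑γ * k) ≤ C) →` — verbatim the ∀-closure of p09's skeleton-v2
`stub_G2_godementCount` (`K2/K2Liu-p09/g0/SKELETON_K2LiuSiegelEisensteinDoubledSummable.lean` dd8a0eeb95649e74 :48); every other byte of #15b unchanged.
HONEST LABEL: HC_CM is proved only modulo the 7 printed citations (2 remaining named inputs:
hLiu418 = stmt-HodgeConjecture-24832, h413 = stmt-HodgeConjecture-24833) until rung 0 closes.
-/

open scoped Matrix
open NumberField IsDedekindDomain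

namespace Summit.HodgeConjecture.HodgeConjecture.Cruxes.HLiu418.K2LiuCurveThetaSigsU3aSiegelEisenstein

open Literature.NumberTheory.Automorphic Literature.NumberTheory.GaloisRepresentations
open Literature.NumberTheory.GelbartRogawski1991 Literature.NumberTheory.GelbartRogawski1991.GRConstruction
open Literature.NumberTheory.K2Lit.SiegelDoubled

/-- socket #10a (U3a) — **the inducing character is trivial on the rational Siegel parabolic**:
for `γ ∈ P_Δ(L⁺) = P_Δ(𝔸) ∩ H(L⁺)`, `χ(det_Δ γ) · |det_Δ γ|_{𝔸_L}^{s + n/2} = 1`, because `det_Δ γ` is a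
PRINCIPAL idele (`χ` is trivial on `L^×` — ★ `HeckeCharacter.map_principal'` — and the product formula,
★ `ideleNorm` of a principal idele `= 1`). This is what makes the summand `f(γ h)` of the Eisenstein series a
function on `P_Δ(L⁺) \ H(L⁺)` (independent of the representative `Quotient.out`). The in-tree step is
`detDelta (toAdelic γ) = algebraMap L 𝔸_L (det of the rational Δ-block)` (definitional bookkeeping through
★ `UnitaryGroup.toAdelic` and `Matrix.map`).
[cite: Liu2021, §B.3 p. 101] [cite: Tan1999, §1]
audit: paper:liu2021-fourier-jacobi-cycles-arithmetic-relative-trace-formula p0101.txt:L29 «series Ja (s, μc ) as the normalized induced representation IndPa (Aa F ) F (μc · | |s ) ◦ detn+a»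
size S–M · deps: ★ `K2Lit.SiegelDoubled.siegelDeltaCharacter` (p854694), ★ `GRConstruction.chiDet ∕ modDelta ∕ detDelta ∕ ratH`,
★ `GaloisRepresentations.HeckeCharacter` (`map_principal'`, `ideleNorm`, product formula) · roads S-A (a = 0 base) and S-B ·
consumed by #10b and by every later file that treats `E(·; f)` as a function on `H(L⁺)\H(𝔸)` · OWNER: open. -/
theorem sig_K2LiuSiegelCharacterTrivialOnRational :
    ∀ (L : Type) [Field L] [NumberField L] [IsCMField L] {N M n : ℕ} (e : Fin N × Fin M ≃ Fin n)
      (dV : Fin N → L) (hdV : ∀ i, IsCMField.complexConj L (dV i) = dV i)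
      (dW : Fin M → L) (hdW : ∀ i, IsCMField.complexConj L (dW i) = dW i)
      (χ : HeckeCharacter L) (s : ℂ) (γ : ratH L e dV hdV dW hdW),
      IsSiegelDelta L e dV hdV dW hdW (γ : HA L e dV hdV dW hdW) →
        siegelDeltaCharacter L e dV hdV dW hdW χ s (γ : HA L e dV hdV dW hdW) = 1 :=
  Summit.HodgeConjecture.HodgeConjecture.Cruxes.HLiu418.K2LiuSiegelCharacterTrivialOnRational.siegelCharacterTrivialOnRational -- ★ PAID (K2Liu-p02), tied ED. 2

/-- socket #10b (U3a) — **left `H(L⁺)`-invariance of the Siegel–hermitian Eisenstein series**: for a Siegel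
section `f` of `I(s, χ)` (★ `IsSiegelDeltaSection`) and `γ ∈ H(L⁺)`, `E(γ h; f) = E(h; f)`. Pure algebra, NO
convergence needed: right multiplication by `γ` permutes `P_Δ(L⁺) \ H(L⁺)`, the summand is
representative-independent by socket #10a, and `tsum` is invariant under re-indexing by an `Equiv`
(`Equiv.tsum_eq`) whatever the summability. (Liu 2021 §B.3: `E_{P_a}(·; f_{a,s})` is a function «on
`U(V_a^◇)(𝔸_F)`» formed from `U(V_a^◇)(F)`-cosets; Tan 1999 §1.)
[cite: Liu2021, §B.3 p. 101] [cite: Tan1999, §1]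
audit: paper:liu2021-fourier-jacobi-cycles-arithmetic-relative-trace-formula p0101.txt:L34 «the Siegel–hermitian Eisenstein series EPa ( ; fa,s ) on U(V )(A ), which»
size S–M · deps: #10a `sig_K2LiuSiegelCharacterTrivialOnRational`, ★ `K2Lit.SiegelDoubled.eisensteinSeriesDelta ∕ SiegelDeltaQuot ∕ siegelDeltaRat`
(p854694), Mathlib `Equiv.tsum_eq`, `MulAction.orbitRel`, `Quotient.out_eq'`-type lemmas · roads S-A and S-B · OWNER: open. -/
theorem sig_K2LiuSiegelEisensteinDoubledLeftInvariant :
    ∀ (L : Type) [Field L] [NumberField L] [IsCMField L] {N M n : ℕ} (e : Fin N × Fin M ≃ Fin n)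
      (dV : Fin N → L) (hdV : ∀ i, IsCMField.complexConj L (dV i) = dV i)
      (dW : Fin M → L) (hdW : ∀ i, IsCMField.complexConj L (dW i) = dW i)
      (χ : HeckeCharacter L) (s : ℂ) (f : HA L e dV hdV dW hdW → ℂ),
      IsSiegelDeltaSection L e dV hdV dW hdW χ s f →
        ∀ (γ : ratH L e dV hdV dW hdW) (h : HA L e dV hdV dW hdW),
          eisensteinSeriesDelta L e dV hdV dW hdW f ((γ : HA L e dV hdV dW hdW) * h) =
            eisensteinSeriesDelta L e dV hdV dW hdW f h :=
  Summit.HodgeConjecture.HodgeConjecture.Cruxes.HLiu418.K2LiuSiegelEisensteinDoubledLeftInvariant.siegelEisensteinDoubledLeftInvariant -- ★ PAID p854756 (K2Liu-p01), tied ED. 2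

/-- socket #9 (U3a) — **absolute convergence of the Siegel–hermitian Eisenstein series for `Re s > n/2`**
(Liu 2021 §B.3 p. 101 «absolutely convergent for Re(s) > (n+a)/2. See [Tan99, Section 1]», here `a = 0` and the
doubled group `H = U(𝕍 ⊕ −𝕍) ≅ U(n, n)`; Godement's criterion): for a UNITARY Hecke character `χ`
(★ `HeckeCharacter.IsUnitary`; Liu's `μ` is conjugate-symplectic of weight one, hence unitary), `Re s > n/2`, and a
CONTINUOUS Siegel section `f` of `I(s, χ)` on `H(𝔸)` (continuity + `H(𝔸) = P_Δ(𝔸) · K` with `K` compact bound `f`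
by a multiple of the spherical height `|det_Δ|^{Re s + n/2}`), the family `γ ↦ f(γ h)` over `P_Δ(L⁺) \ H(L⁺)` is
absolutely summable for every `h ∈ H(𝔸)`; hence ★ `eisensteinSeriesDelta f h` IS the sum (no junk value). The
non-degeneracy `dV i ≠ 0`, `dW i ≠ 0` of the datum is carried (reduction theory is for the reductive `H`).
The modulus of the Siegel parabolic of `U(n,n) ≤ GL_{2n}(E)` is `|det a|_E^{n}`, so the unnormalised exponent
`s + n/2` passes Godement's bound `n` exactly when `Re s > n/2` (matches Liu's `(n+a)/2` with Witt rank `n + a`).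
GENUINE ANALYTIC ORGAN (XL in Lean: Iwasawa decomposition of `H(𝔸)`, compactness of `P_Δ(𝔸)\H(𝔸)`, a lattice-point ∕
integral comparison on `Res GL_n`); Mathlib has none of it (2026-09).
[cite: Liu2021, §B.3 p. 101 & Lem. B.10 (2) p. 102] [cite: Tan1999, §1]
audit: paper:liu2021-fourier-jacobi-cycles-arithmetic-relative-trace-formula p0101.txt:L38 «is absolutely convergent for Re(s) > (n+a)/2 . See [Tan99, Section 1] for more»
size XL · deps: ★ `K2Lit.SiegelDoubled.*` (p854694), #10a, ★ `GRConstruction.HA ∕ ratH`, ★ `HeckeCharacter.IsUnitary`,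
Mathlib `Summable`, `Continuous`; WANTED for the printed proof: [Tan1999 §1] HELD (paper:doi-10-4153-cjm-1999-010-4),
Godement's convergence lemma (Borel, *Introduction to automorphic forms*, PSPM 9 (1966) Thm. 11.2 ∕ MW95 II.1.5 — holdings to be
checked by the prover; `lit want` if absent) · roads S-A (a = 0 base case; the tower case is the rank-generic twin over
★ `K2Lit.SiegelUnitary`, a later socket) and S-B · OWNER: open. -/
theorem sig_K2LiuSiegelEisensteinDoubledSummable :
    ∀ (L : Type) [Field L] [NumberField L] [IsCMField L] {N M n : ℕ} (e : Fin N × Fin M ≃ Fin n)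
      (dV : Fin N → L) (hdV : ∀ i, IsCMField.complexConj L (dV i) = dV i) (_hdV0 : ∀ i, dV i ≠ 0)
      (dW : Fin M → L) (hdW : ∀ i, IsCMField.complexConj L (dW i) = dW i) (_hdW0 : ∀ i, dW i ≠ 0)
      (χ : HeckeCharacter L), χ.IsUnitary →
        ∀ (s : ℂ), (n : ℝ) / 2 < s.re →
          ∀ f : HA L e dV hdV dW hdW → ℂ, IsSiegelDeltaSection L e dV hdV dW hdW χ s f → Continuous f →
            ∀ h : HA L e dV hdV dW hdW,
              Summable (fun q : SiegelDeltaQuot L e dV hdV dW hdW =>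
                ‖f (((Quotient.out q : ratH L e dV hdV dW hdW) : HA L e dV hdV dW hdW) * h)‖) :=
  Summit.HodgeConjecture.HodgeConjecture.Cruxes.HLiu418.K2LiuSiegelEisensteinDoubledSummable.siegelEisensteinDoubledSummable -- ★ PAID p856279 (K2Liu-p09 g0), tied ED. 5


/-- socket «IWASAWA DATUM» (U3a ED. 2; size S given ★ p854827; CONSTRUCTION statement for the ★ D1′ interface `K2Lit.SiegelDoubled.IwasawaDatum`
(p854837): existence is deliberately NOT a field of the interface; OWNER K2Liu-p09 lineage (LEAD 21:14:52Z: paid by the one-line corollary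
`iwasawaDatum_nonempty` of ★ `Theorems/K2LiuSiegelDoubledIwasawaCompact.exists_isCompact_isSiegelDelta_mul` once the compact SET built there
(`adelicVal`-preimage of the `S`-conjugate of ★ `standardMaximalCompactGL`) is exposed as the SUBGROUP it is — type delta flagged 21:20:26Z)) —
**for non-degenerate data the doubled unitary group `H(𝔸) = U(𝕍 ⊕ −𝕍)(𝔸)` admits an Iwasawa datum**: a compact subgroup `K ≤ H(𝔸)` with
`H(𝔸) = P_Δ(𝔸)·K`. Consumers: the tier-0 line's ED.3 binders `(𝒦 : IwasawaDatum …)` (s23 ∃ ∕ s5 ∀, «M-154n» R5), #10c, #14a, #15.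
DEGENERATE-CORNER PASS: `n = 0` trivially true; `dV i = 0 ∕ dW j = 0` excluded by the binders (p09's ★ needs `isUnit_det_gramR₀`).
Why it might fail: it cannot beyond the Set→Subgroup bookkeeping (the construction is ★). [cite: GelbartRogawski1991, §1] [cite: Tan1999, §1] -/
theorem sig_K2LiuIwasawaDatumNonempty :
    ∀ (L : Type) [Field L] [NumberField L] [IsCMField L] {N M n : ℕ} (e : Fin N × Fin M ≃ Fin n)
      (dV : Fin N → L) (hdV : ∀ i, IsCMField.complexConj L (dV i) = dV i) (_hdV0 : ∀ i, dV i ≠ 0)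
      (dW : Fin M → L) (hdW : ∀ i, IsCMField.complexConj L (dW i) = dW i) (_hdW0 : ∀ i, dW i ≠ 0),
      Nonempty (IwasawaDatum L e dV hdV dW hdW) :=
  Summit.HodgeConjecture.HodgeConjecture.Cruxes.HLiu418.K2LiuIwasawaDatumNonempty.iwasawaDatumNonempty -- ★ PAID p855101 (K2Liu-p09), tied ED. 4

/-- socket #15a (U3a ED. 2; ★ PAID p854993 (K2Liu-p07) `Theorems/K2LiuSiegelDeltaHeightExists.siegelDeltaHeightExists`, statement BYTE-IDENTICAL,
TIED BY NAME in ED. 3; organ (III-G1) of #9; size M–L; OWNER K2Liu-p09 lineage; cut VERBATIM from p09's consumer skeleton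
`K2/K2Liu-p09/g0/SKELETON_K2LiuSiegelEisensteinDoubledSummable.lean` dab9be1641999f4c `stub_G1_exists_continuous_height` :39; shape ruled by LEAD
21:16:48Z (∃Φ ∕ ∀Φ split so neither smuggles the other)) — **A CONTINUOUS `P_Δ`-HEIGHT EXISTS**: for non-degenerate data there is a continuous
`Φ : H(𝔸) → ℝ_{>0}` of type `(P_Δ, modDelta)`, `Φ(p x) = |det_Δ p|^{1/2}·Φ(x)` — e.g. `Φ(h) = modDelta(p_h)` for any Iwasawa decomposition
`h = p_h k_h` (well defined since `|det_Δ| = 1` on `P_Δ(𝔸) ∩ K`; continuity via a local section ∕ the minors height), or the inverse square root of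
the adelic height of the vector of `n × n` minors of the `Δ`-rows. The cell's HEIGHT OF RECORD (LEAD 21:20:27Z): one Φ shared by #9 #14a #15b #16.
DEGENERATE-CORNER PASS: `n = 0`: `Φ ≡ 1` ✓; `dV ∕ dW = 0` excluded; isotropy of `V` irrelevant (`H` is quasi-split always).
Why it might fail: only through a continuity slip in the Iwasawa-section definition (the minors-height definition is manifestly continuous).
[cite: Garrett2018, §3.10] [cite: MoeglinWaldspurger1995, I.2.2, II.1.5] -/
theorem sig_K2LiuSiegelDeltaHeightExists :
    ∀ (L : Type) [Field L] [NumberField L] [IsCMField L] {N M n : ℕ} (e : Fin N × Fin M ≃ Fin n)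
      (dV : Fin N → L) (hdV : ∀ i, IsCMField.complexConj L (dV i) = dV i) (_hdV0 : ∀ i, dV i ≠ 0)
      (dW : Fin M → L) (hdW : ∀ i, IsCMField.complexConj L (dW i) = dW i) (_hdW0 : ∀ i, dW i ≠ 0),
      ∃ Φ : HA L e dV hdV dW hdW → ℝ, Continuous Φ ∧ (∀ x, 0 < Φ x) ∧
        ∀ p x : HA L e dV hdV dW hdW, IsSiegelDelta L e dV hdV dW hdW p →
          Φ (p * x) = modDelta L e dV hdV dW hdW p * Φ x :=
  Summit.HodgeConjecture.HodgeConjecture.Cruxes.HLiu418.K2LiuSiegelDeltaHeightExists.siegelDeltaHeightExists -- ★ PAID p854993 (K2Liu-p07), tied ED. 3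

/-- socket #15b (U3a ED. 2, RE-TYPED ED. 3 on K2Liu-p09's «≠» 21:40:57Z: `Continuous Φ →` ↦ the two floors (3) compact floor, (4) Godement floor of
★ `exists_siegelHeight` — measurability∕continuity is NOT needed for a SUM, and (4) with `γ = 1`, `K` = ★ Iwasawa compact bounds `Φ` above on `K`, so the
∀Φ form stays equivalent to the one-height form by the type law; organ (III-G2) of #9 = **GODEMENT'S COUNT, THE ENGINE**; size XL; OWNER K2Liu-p09 lineage; cut VERBATIM from p09's
`stub_G2_summable_height_rpow` :50 of the same skeleton; ∀Φ shape (LEAD 21:16:48Z; equivalent to the ∃Φ form because two heights of one type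
differ by a function on the compact `P_Δ(𝔸)\H(𝔸)` = image of ★ K bounded above and below — p09's helper №3)) — for every height
`Φ > 0` of type `(P_Δ, modDelta)` with the floors (3)–(4) and `τ > 2n`: `Σ_{γ ∈ P_Δ(L⁺)\H(L⁺)} Φ(γ h)^τ < ∞` (`modDelta = |det_Δ|^{1/2}`, so this is `Σ |det_Δ γh|^{τ/2}`
with `τ/2 > n = ⟨ρ_{P_Δ}, α^∨⟩`, Godement's threshold for the Siegel parabolic of `U(n,n)`). Route [Garrett2018 §3.10, proof of Cor. 3.10.2]:
smear over a small compact, height floor, unfold with bounded multiplicity, `∫_{P_Δ(L⁺)\{Φ ≤ C}} Φ^τ < ∞` via `N(L⁺)\N(𝔸)` compact + reduction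
theory for the Levi `GL_n(𝔸_L)` (★ `reductionTheory_gl`, ★ `measure_mul_siegelSet_lt_top`). With ★ p854785 (reduction) + ★ p854827 (I) + #15a
this closes #9 BY NAME. DEGENERATE-CORNER PASS: `n = 0`: one coset, summable ✓; `dV ∕ dW = 0` excluded; `V` isotropic irrelevant.
Why it might fail: the threshold — `2n < τ` is Godement's sharp abscissa for `P_Δ ≤ U(n,n)` over `L⁺` (sum over `L⁺`-points, height normalised
by `|·|_{𝔸_L}^{1/2}`); a normalisation slip by a factor 2 (`|·|_{𝔸_L}` vs `|·|_{𝔸_{L⁺}}`) would move it to `τ > n` or `τ > 4n` — p09's (II)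
reduction fixed the convention (`2·Re s + n > 2n ⇔ Re s > n/2` = Liu B.10 (2) at a = 0 ✓).
[cite: Garrett2018, §3.10] [cite: MoeglinWaldspurger1995, II.1.5] [cite: Liu2021, Lem. B.10 (2) p. 102] -/
theorem sig_K2LiuSiegelDeltaHeightCount :
    ∀ (L : Type) [Field L] [NumberField L] [IsCMField L] {N M n : ℕ} (e : Fin N × Fin M ≃ Fin n)
      (dV : Fin N → L) (hdV : ∀ i, IsCMField.complexConj L (dV i) = dV i) (_hdV0 : ∀ i, dV i ≠ 0)
      (dW : Fin M → L) (hdW : ∀ i, IsCMField.complexConj L (dW i) = dW i) (_hdW0 : ∀ i, dW i ≠ 0)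
      (Φ : HA L e dV hdV dW hdW → ℝ), (∀ x, 0 < Φ x) →
      (∀ p x : HA L e dV hdV dW hdW, IsSiegelDelta L e dV hdV dW hdW p →
        Φ (p * x) = modDelta L e dV hdV dW hdW p * Φ x) →
      (∀ K : Set (HA L e dV hdV dW hdW), IsCompact K → ∃ c : ℝ, 0 < c ∧ ∀ k ∈ K, c ≤ Φ k) →
      (∀ K : Set (HA L e dV hdV dW hdW), IsCompact K → ∃ C : ℝ, ∀ k ∈ K, ∀ γ : ratH L e dV hdV dW hdW,
        Φ ((γ : HA L e dV hdV dW hdW) * k) ≤ C) →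
      ∀ (τ : ℝ), 2 * (n : ℝ) < τ → ∀ (h : HA L e dV hdV dW hdW),
        Summable (fun q : SiegelDeltaQuot L e dV hdV dW hdW =>
          Φ (((Quotient.out q : ratH L e dV hdV dW hdW) : HA L e dV hdV dW hdW) * h) ^ τ) :=
  Summit.HodgeConjecture.HodgeConjecture.Cruxes.HLiu418.K2LiuSiegelDeltaHeightCount.siegelDeltaHeightCount -- ★ PAID p856397 (K2Liu-p09 g2), tied ED. 5

end Summit.HodgeConjecture.HodgeConjecture.Cruxes.HLiu418.K2LiuCurveThetaSigsU3aSiegelEisenstein
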